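import Summits.ResolutionOfSingularities.ResolutionOfSingularities.Theorems.ValuativeLuAlphaPTorsorAdaptedDefs
import Summits.ResolutionOfSingularities.ResolutionOfSingularities.Theorems.ValuativeLuAlphaPTorsorAPDict
import Summits.ResolutionOfSingularities.ResolutionOfSingularities.Theorems.ValuativeLuAlphaPTorsorAPExt
import Literature.AlgebraicGeometry.Resolution.CompositeValuations
import Literature.AlgebraicGeometry.Resolution.TranscendenceDefect
import Mathlib.RingTheory.Valuation.ValuationSubring
import Mathlib.RingTheory.Ideal.Operations
import Mathlib.RingTheory.LocalRing.MaximalIdeal.Basic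
import HarnessLib

/-!
# Level calculus for adapted charts, II-A: the UP-lemma, first half (centre, independence, C2a, C2b)

Crux `Valuative.LuAlphaPTorsor` (stmt-ResolutionOfSingularities-0641), line `pfaff-line-log-final-forms`,
lead seat c4 — the attack on the rank `≥ 2` Abhyankar core `stub_abhyankarHigherRankCore`. The
UP-lemma (`ap_flagAdaptedChart_of_residual`, file II-B `…APUpB`) shows that a chart lifted from the
residue field of the top coarsening `W` is FLAG-ADAPTED (`FlagAdaptedChart`): if `W ⊇ O` is cut out
by the Laurent monomials in the parameters of level `< top`, of rank one, `(R, y_top)` is a very good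
`W`-chart, the lower parameters are `O`-non-units, and the image of `R` in `κ(W)` with the residues
of the lower parameters (same levels) is a flag-adapted chart for `O/𝔪_W`, then `(R, y, lv)` is a
flag-adapted chart for `O`. This file: the lower parameters are `W`-units (`ap_up_lowW`, registered
anchor) and the clauses "centre", "independence", (C2a), (C2b) (`ap_up_partA`). [folklore]
(Zariski 1940; Cutkosky 2022 §4.)
-/

set_option linter.dupNamespace false

open IsLocalRing

namespace Summit.ResolutionOfSingularities.ResolutionOfSingularities.Theorems.PfaffLine

open Literature.AlgebraicGeometry.Resolution

/-- The lower parameters of a chart whose top coarsening `W` is cut out by their Laurent monomials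
are units of `W` (registered anchor). [folklore] -/
theorem ap_up_lowW : ∀ {K : Type} [Field K] (O W : ValuationSubring K) {n : ℕ} (y : Fin n → K) (lv : Fin n → ℕ) (top : ℕ), (∀ z : K, z ∈ W ↔ ∃ m : Fin n → ℤ, (∀ j, top ≤ lv j → m j = 0) ∧ O.valuation z ≤ ∏ j, O.valuation (y j) ^ (m j)) → ∀ i, lv i < top → y i ∈ W ∧ (y i)⁻¹ ∈ W := by
  intro K _ O W n y lv top hWmem i hi
  classical
  constructor
  · rw [hWmem]
    refine ⟨Pi.single i 1, fun j hj => ?_, ?_⟩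
    · have : j ≠ i := by rintro rfl; exact absurd hi (not_lt.mpr hj)
      simp [this]
    · rw [Finset.prod_eq_single i (fun j _ hj => by simp [hj]) (by simp)]
      simp
  · rw [hWmem]
    refine ⟨Pi.single i (-1), fun j hj => ?_, ?_⟩
    · have : j ≠ i := by rintro rfl; exact absurd hi (not_lt.mpr hj)
      simp [this]
    · rw [Finset.prod_eq_single i (fun j _ hj => by simp [hj]) (by simp)]
      simp [map_inv₀]

section Up

variable {k K : Type} [Field k] [Field K] [Algebra k K]

/-- **UP-lemma, first half**: under the hypotheses of `ap_flagAdaptedChart_of_residual` (file II-B),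
the parameters generate the centre of `O`, their values are `ℤ`-independent, and the value clauses
(C2a), (C2b) of `AdaptedValues` hold. [folklore] -/
theorem ap_up_partA (O : ValuationSubring K) (hk : ∀ c : k, algebraMap k K c ∈ O)
    {n : ℕ} (R : Subalgebra k K) (hRO : R.toSubring ≤ O.toSubring) (y : Fin n → K)
    (hy : ∀ i, y i ∈ R) (lv : Fin n → ℕ) (top : ℕ) (hle : ∀ i, lv i ≤ top) (_ : ∃ i, lv i = top)
    (W : ValuationSubring K) (hOW : O ≤ W)
    (hWmem : ∀ z : K, z ∈ W ↔ ∃ m : Fin n → ℤ, (∀ j, top ≤ lv j → m j = 0) ∧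
      O.valuation z ≤ ∏ j, O.valuation (y j) ^ (m j))
    (hWr1 : ∀ z w : K, W.valuation z < 1 → w ≠ 0 → ∃ N : ℕ, W.valuation z ^ N < W.valuation w)
    (_ : R.FG) (hy0 : ∀ i, y i ≠ 0)
    (hWspan : Ideal.span (Set.range fun i : {i : Fin n // lv i = top} => (⟨y i.1, hy i.1⟩ : R.toSubring)) =
      Ideal.comap (Subring.inclusion (show R.toSubring ≤ W.toSubring from fun _ hz => hOW (hRO hz)))
        (maximalIdeal W))
    (hWind : ∀ μ : Fin n → ℤ, (∀ j, lv j ≠ top → μ j = 0) →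
      W.valuation (∏ j, y j ^ (μ j)) = 1 → μ = 0)
    (hySv : ∀ i, lv i < top → O.valuation (y i) < 1)
    (nS : ℕ) (e : Fin nS ≃ {i : Fin n // lv i < top})
    (hres : letI := algebraOfMem k W (fun c => hOW (hk c))
      ∃ (Rb : Subalgebra k (ResidueField W))
        (hRb : Rb.toSubring ≤ (residueValuationSubring O W hOW).toSubring)
        (xb : Fin nS → ResidueField W) (hxb : ∀ j, xb j ∈ Rb),
        (∀ j, residue W ⟨y (e j).1, hOW (hRO (hy (e j).1))⟩ = xb j) ∧
        (∀ (r : K) (hr : r ∈ R), residue W ⟨r, hOW (hRO hr)⟩ ∈ Rb) ∧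
        (∀ rb ∈ Rb, ∃ (r : K) (hr : r ∈ R), residue W ⟨r, hOW (hRO hr)⟩ = rb) ∧
        FlagAdaptedChart (residueValuationSubring O W hOW) Rb hRb xb hxb (fun j => lv (e j).1)) :
    Ideal.span (Set.range fun i => (⟨y i, hy i⟩ : R.toSubring)) =
        Ideal.comap (Subring.inclusion hRO) (maximalIdeal O) ∧
      (∀ μ : Fin n → ℤ, (∏ i, O.valuation (y i) ^ (μ i)) = 1 → μ = 0) ∧
      (∀ i i', lv i < lv i' → ∀ m : Fin n → ℤ, (∀ j, lv i < lv j → m j = 0) →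
        O.valuation (y i') < ∏ j, O.valuation (y j) ^ (m j)) ∧
      (∀ i i', lv i = lv i' → ∃ N : ℕ, O.valuation (y i) ^ N < O.valuation (y i')) := by
  classical
  letI := algebraOfMem k W (fun c => hOW (hk c))
  obtain ⟨Rb, hRb, xb, hxb, hxbeq, hπR, hπsurj, hres⟩ := hres
  obtain rfl : xb = fun j => residue W ⟨y (e j).1, hOW (hRO (hy (e j).1))⟩ :=
    funext fun j => (hxbeq j).symm
  obtain ⟨⟨hbFG, hxb0, hbspan, hbind, ⟨hbC2a, hbC2b, hbC4⟩, hbC3⟩, hbLA⟩ := hres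
  dsimp only at hbC2a hbC2b hbC4 hbC3 hbLA hbind hxb0
  set Ob := residueValuationSubring O W hOW with hOb
  -- notation-free abbreviations
  have hRW : R.toSubring ≤ W.toSubring := fun z hz => hOW (hRO hz)
  have hvy0 : ∀ i, O.valuation (y i) ≠ 0 := fun i => (map_ne_zero _).mpr (hy0 i)
  have hpos : ∀ m : Fin n → ℤ, 0 < ∏ j, O.valuation (y j) ^ (m j) := fun m =>
    Finset.prod_pos fun j _ => zpow_pos (zero_lt_iff.mpr (hvy0 j)) _
  have hprodK : ∀ m : Fin n → ℤ, O.valuation (∏ j, y j ^ (m j)) = ∏ j, O.valuation (y j) ^ (m j) := by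
    intro m; rw [map_prod]; exact Finset.prod_congr rfl fun j _ => map_zpow₀ _ _ _
  have hprodK0 : ∀ m : Fin n → ℤ, (∏ j, y j ^ (m j)) ≠ 0 := fun m =>
    Finset.prod_ne_zero_iff.mpr fun j _ => zpow_ne_zero _ (hy0 j)
  -- (1) the lower parameters are units of `W`
  have hlowW : ∀ i, lv i < top → y i ∈ W ∧ (y i)⁻¹ ∈ W := ap_up_lowW O W y lv top hWmem
  have hlowu : ∀ i, lv i < top → W.valuation (y i) = 1 := fun i hi =>
    (ap_valuation_eq_one_iff_mem_inv_mem W (hy0 i)).mpr (hlowW i hi)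
  -- (2) `W`-smallness = smaller than every lower Laurent monomial
  have hWlt : ∀ z : K, W.valuation z < 1 ↔
      ∀ m : Fin n → ℤ, (∀ j, top ≤ lv j → m j = 0) → O.valuation z < ∏ j, O.valuation (y j) ^ (m j) :=
    ap_valuation_lt_one_iff_forall O W y (fun m => ∀ j, top ≤ lv j → m j = 0) hy0
      (fun _ _ => rfl) (fun m hm j hj => by rw [Pi.neg_apply, hm j hj, neg_zero]) hWmem
  -- (3) the `W`-centre of `R`
  have hWR : ∀ (z : R.toSubring), W.valuation (z : K) < 1 ↔
      z ∈ Ideal.span (Set.range fun i : {i : Fin n // lv i = top} => (⟨y i.1, hy i.1⟩ : R.toSubring)) := by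
    intro z
    rw [hWspan, Ideal.mem_comap, ValuationSubring.valuation_lt_one_iff]
    rfl
  have htopW : ∀ i, lv i = top → W.valuation (y i) < 1 := by
    intro i hi
    rw [show y i = ((⟨y i, hy i⟩ : R.toSubring) : K) from rfl, hWR]
    exact Ideal.subset_span ⟨⟨i, hi⟩, rfl⟩
  have hylt : ∀ i, O.valuation (y i) < 1 := by
    intro i
    rcases (hle i).lt_or_eq with hi | hi
    · exact hySv i hi
    · have h := (hWlt _).mp (htopW i hi) 0 (fun _ _ => rfl)
      simpa using h
  -- `W`-small ⇒ `O`-small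
  have hWO : ∀ z : K, W.valuation z < 1 → O.valuation z < 1 := by
    intro z hz
    have h := (hWlt z).mp hz 0 (fun _ _ => rfl)
    simpa using h
  have hmemW : ∀ z : K, z ∈ O → z ∈ W := fun z hz => hOW hz
  -- (4) the ring homomorphism `φ : R → κ(W)`
  let φ : R.toSubring →+* ResidueField W := (residue W).comp (Subring.inclusion hRW)
  have hφ : ∀ (z : R.toSubring), φ z = residue W ⟨(z : K), hRW z.2⟩ := fun z => rfl
  have hφ0 : ∀ (z : R.toSubring), φ z = 0 ↔ W.valuation (z : K) < 1 := by
    intro z; rw [hφ, ap_residue_eq_zero_iff]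
  -- lower parameters as elements of `R`, their residues
  have hySW : ∀ j : Fin nS, y (e j) ∈ W ∧ (y (e j))⁻¹ ∈ W := fun j => hlowW _ (e j).2
  have hySu : ∀ j : Fin nS, W.valuation (y (e j)) = 1 := fun j => hlowu _ (e j).2
  -- Laurent monomials in the lower parameters
  have hmonW : ∀ m : Fin nS → ℤ, (∏ j, y (e j) ^ (m j)) ∈ W := by
    intro m
    refine prod_mem fun j _ => ?_
    rcases Int.eq_nat_or_neg (m j) with ⟨N, h | h⟩
    · rw [h, zpow_natCast]; exact pow_mem (hySW j).1 N
    · rw [h, zpow_neg, zpow_natCast, ← inv_pow]; exact pow_mem (hySW j).2 N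
  have hmonu : ∀ m : Fin nS → ℤ, W.valuation (∏ j, y (e j) ^ (m j)) = 1 := by
    intro m; rw [map_prod]; exact Finset.prod_eq_one fun j _ => by rw [map_zpow₀, hySu, one_zpow]
  have hmonπ : ∀ m : Fin nS → ℤ, residue W ⟨∏ j, y (e j) ^ (m j), hmonW m⟩ =
      ∏ j, residue W ⟨y (e j).1, hOW (hRO (hy (e j).1))⟩ ^ (m j) :=
    fun m => ap_residue_prod_zpow W (fun j => y (e j)) (fun j => (hySW j).1) (fun j => (hySW j).2)
      (fun j => hy0 _) m (hmonW m)
  have hmonOb : ∀ m : Fin nS → ℤ, (∏ j, Ob.valuation (residue W ⟨y (e j).1, hOW (hRO (hy (e j).1))⟩) ^ (m j)) =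
      Ob.valuation (residue W ⟨∏ j, y (e j) ^ (m j), hmonW m⟩) := by
    intro m; rw [hmonπ, map_prod]
    exact Finset.prod_congr rfl fun j _ => (map_zpow₀ _ _ _).symm
  have hmonO : ∀ m : Fin nS → ℤ, O.valuation (∏ j, y (e j) ^ (m j)) = ∏ j, O.valuation (y (e j)) ^ (m j) := by
    intro m; rw [map_prod]; exact Finset.prod_congr rfl fun j _ => map_zpow₀ _ _ _
  -- extension by zero
  have hextP : ∀ (m : Fin nS → ℤ) (ℓ : ℕ), (∀ j, ℓ ≤ lv (e j) → m j = 0) → ℓ ≤ top →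
      ∀ i, ℓ ≤ lv i → Function.extend (fun j => ((e j : {i : Fin n // lv i < top}) : Fin n)) m 0 i = 0 :=
    fun m ℓ hm _ => ap_ext_vanish lv top e m ℓ hm
  -- TRANSFER of strict inequalities between lower monomials
  have htr : ∀ m m' : Fin nS → ℤ,
      (∏ j, Ob.valuation (residue W ⟨y (e j).1, hOW (hRO (hy (e j).1))⟩) ^ (m j)) <
        (∏ j, Ob.valuation (residue W ⟨y (e j).1, hOW (hRO (hy (e j).1))⟩) ^ (m' j)) ↔
      (∏ j, O.valuation (y (e j)) ^ (m j)) < ∏ j, O.valuation (y (e j)) ^ (m' j) := by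
    intro m m'
    rw [hmonOb, hmonOb, ap_resval_lt_iff O W hOW (hmonW m) (hmonW m') (hmonu m), hmonO, hmonO]
  -- transfer for a `W`-unit of `R` against a lower monomial
  have htrz : ∀ (z : K) (hzW : z ∈ W) (hzu : W.valuation z = 1) (m : Fin nS → ℤ),
      Ob.valuation (residue W ⟨z, hzW⟩) <
        (∏ j, Ob.valuation (residue W ⟨y (e j).1, hOW (hRO (hy (e j).1))⟩) ^ (m j)) ↔
      O.valuation z < ∏ j, O.valuation (y (e j)) ^ (m j) := by
    intro z hzW hzu m
    rw [hmonOb, ap_resval_lt_iff O W hOW hzW (hmonW m) hzu, hmonO]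
  -- LIFT from a residual span: if `φ z ∈ (x̄_j : q j)` then `z ∈ (y_(e j) : q j) + (y_top)`
  have hlift : ∀ (q : Fin nS → Prop) (z : R.toSubring),
      (⟨φ z, by rw [hφ]; exact hπR _ z.2⟩ : Rb.toSubring) ∈
        Ideal.span (Set.range fun j : {j : Fin nS // q j} =>
          (⟨residue W ⟨y (e j.1).1, hOW (hRO (hy (e j.1).1))⟩, hxb j.1⟩ : Rb.toSubring)) →
      z ∈ Ideal.span (Set.range fun j : {j : Fin nS // q j} => (⟨y (e j.1).1, hy (e j.1).1⟩ : R.toSubring)) ⊔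
        Ideal.span (Set.range fun i : {i : Fin n // lv i = top} => (⟨y i.1, hy i.1⟩ : R.toSubring)) := by
    intro q z hz
    obtain ⟨cb, hcb⟩ := Ideal.mem_span_range_iff_exists_fun.mp hz
    -- lift the coefficients
    have hc : ∀ j : {j : Fin nS // q j}, ∃ (c : R.toSubring), φ c = (cb j : ResidueField W) := by
      intro j
      obtain ⟨r, hr, hrr⟩ := hπsurj _ (cb j).2
      exact ⟨⟨r, hr⟩, hrr⟩
    choose c hc using hc
    set w : R.toSubring := z - ∑ j, c j * ⟨y (e j.1).1, hy (e j.1).1⟩ with hw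
    have hφw : φ w = 0 := by
      have h1 : φ z = ∑ j, φ (c j) * φ ⟨y (e j.1).1, hy (e j.1).1⟩ := by
        have := congrArg (fun t : Rb.toSubring => (t : ResidueField W)) hcb
        simp only [AddSubmonoidClass.coe_finsetSum, Subring.coe_mul] at this
        rw [← this]
        exact Finset.sum_congr rfl fun j _ => by rw [hc j]; rfl
      rw [hw, map_sub, map_sum, h1]
      simp only [map_mul, sub_self]
    have hwW : W.valuation (w : K) < 1 := (hφ0 w).mp hφw
    have hwspan := (hWR w).mp hwW
    have hz : z = (∑ j, c j * ⟨y (e j.1).1, hy (e j.1).1⟩) + w := by rw [hw]; ring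
    rw [hz]
    refine Ideal.add_mem _ (Ideal.mem_sup_left ?_) (Ideal.mem_sup_right hwspan)
    exact Ideal.sum_mem _ fun j _ => Ideal.mul_mem_left _ _ (Ideal.subset_span ⟨j, rfl⟩)
  -- SPAN = CENTRE
  have hspan : Ideal.span (Set.range fun i => (⟨y i, hy i⟩ : R.toSubring)) =
      Ideal.comap (Subring.inclusion hRO) (maximalIdeal O) := by
    apply le_antisymm
    · rw [Ideal.span_le]
      rintro _ ⟨i, rfl⟩
      rw [SetLike.mem_coe, Ideal.mem_comap, ValuationSubring.valuation_lt_one_iff]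
      exact hylt i
    · intro z hz
      rw [Ideal.mem_comap, ValuationSubring.valuation_lt_one_iff] at hz
      change O.valuation (z : K) < 1 at hz
      by_cases hzW : W.valuation (z : K) < 1
      · exact Ideal.span_mono (by rintro _ ⟨i, rfl⟩; exact ⟨i.1, rfl⟩) ((hWR z).mp hzW)
      · have hzu : W.valuation (z : K) = 1 :=
          le_antisymm ((W.valuation_le_one_iff _).mpr (hRW z.2)) (not_lt.mp hzW)
        have hπz : Ob.valuation (residue W ⟨(z : K), hRW z.2⟩) < 1 :=
          (ap_resval_lt_one_iff O W hOW (hRW z.2) hzu).mpr hz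
        have hmem : (⟨φ z, by rw [hφ]; exact hπR _ z.2⟩ : Rb.toSubring) ∈
            Ideal.comap (Subring.inclusion hRb) (maximalIdeal Ob) := by
          rw [Ideal.mem_comap, ValuationSubring.valuation_lt_one_iff]; exact hπz
        rw [← hbspan] at hmem
        have hmem' : (⟨φ z, by rw [hφ]; exact hπR _ z.2⟩ : Rb.toSubring) ∈
            Ideal.span (Set.range fun j : {j : Fin nS // True} =>
              (⟨residue W ⟨y (e j.1).1, hOW (hRO (hy (e j.1).1))⟩, hxb j.1⟩ : Rb.toSubring)) := by
          refine Ideal.span_mono ?_ hmem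
          rintro _ ⟨j, rfl⟩; exact ⟨⟨j, trivial⟩, rfl⟩
        have h := hlift (fun _ => True) z hmem'
        have hle2 : Ideal.span (Set.range fun j : {j : Fin nS // True} => (⟨y (e j.1).1, hy (e j.1).1⟩ : R.toSubring)) ⊔
            Ideal.span (Set.range fun i : {i : Fin n // lv i = top} => (⟨y i.1, hy i.1⟩ : R.toSubring)) ≤
            Ideal.span (Set.range fun i => (⟨y i, hy i⟩ : R.toSubring)) :=
          sup_le (Ideal.span_mono (by rintro _ ⟨j, rfl⟩; exact ⟨(e j.1).1, rfl⟩))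
            (Ideal.span_mono (by rintro _ ⟨i, rfl⟩; exact ⟨i.1, rfl⟩))
        exact hle2 h
  -- INDEPENDENCE
  have hind : ∀ μ : Fin n → ℤ, (∏ i, O.valuation (y i) ^ (μ i)) = 1 → μ = 0 := by
    intro μ hμ
    set μT : Fin n → ℤ := fun i => if lv i = top then μ i else 0 with hμT
    set μS : Fin n → ℤ := fun i => if lv i = top then 0 else μ i with hμS
    have hsplit : ∀ i, μ i = μT i + μS i := by intro i; simp only [hμT, hμS]; split_ifs <;> simp
    have hWμ : W.valuation (∏ j, y j ^ (μ j)) = 1 := by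
      rw [ap_valuation_eq_one_iff_mem_inv_mem W (hprodK0 μ)]
      have h1 : O.valuation (∏ j, y j ^ (μ j)) = 1 := by rw [hprodK, hμ]
      refine ⟨hOW ((O.valuation_le_one_iff _).mp h1.le), hOW ((O.valuation_le_one_iff _).mp ?_)⟩
      rw [map_inv₀, h1, inv_one]
    have hWμS : W.valuation (∏ j, y j ^ (μS j)) = 1 := by
      rw [map_prod]
      refine Finset.prod_eq_one fun j _ => ?_
      simp only [hμS]
      split_ifs with hj
      · simp
      · rw [map_zpow₀, hlowu j (lt_of_le_of_ne (hle j) hj), one_zpow]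
    have hWμT : W.valuation (∏ j, y j ^ (μT j)) = 1 := by
      have : (∏ j, y j ^ (μ j)) = (∏ j, y j ^ (μT j)) * ∏ j, y j ^ (μS j) := by
        rw [← Finset.prod_mul_distrib]
        exact Finset.prod_congr rfl fun j _ => by rw [← zpow_add₀ (hy0 j), ← hsplit]
      rw [this, map_mul, hWμS, mul_one] at hWμ
      exact hWμ
    have hμT0 : μT = 0 := hWind μT (fun j hj => by simp [hμT, hj]) hWμT
    have hμS' : ∀ i, ¬ lv i < top → μ i = 0 := by
      intro i hi
      have hi' : lv i = top := le_antisymm (hle i) (not_lt.mp hi)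
      have := congrFun hμT0 i
      simpa [hμT, hi'] using this
    -- restrict to the lower indices and transfer
    have hμext := ap_ext_restrict lv top e μ hμS'
    have h1 : (∏ j, O.valuation (y (e j)) ^ (μ (e j))) = 1 := by
      rw [← hμ, ← ap_prod_ext lv top e (fun i => O.valuation (y i)) (fun j => μ (e j)), hμext]
    have h2 : (∏ j, Ob.valuation (residue W ⟨y (e j).1, hOW (hRO (hy (e j).1))⟩) ^ (μ (e j))) = 1 := by
      rw [hmonOb]
      have h := (ap_resval_eq_iff O W hOW (hmonW fun j => μ (e j)) W.one_mem (hmonu _) (by rw [map_one])).mpr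
        (by rw [hmonO, h1, map_one])
      rw [h]
      have : (residue W ⟨(1 : K), W.one_mem⟩) = 1 := by rw [← map_one (residue W)]; rfl
      rw [this, map_one]
    have h3 := hbind (fun j => μ (e j)) h2
    rw [← hμext]
    funext i
    by_cases hi : lv i < top
    · have h := ap_ext_apply_low lv top e (fun j => μ (e j)) (e.symm ⟨i, hi⟩)
      simp only [Equiv.apply_symm_apply] at h
      rw [h]
      have := congrFun h3 (e.symm ⟨i, hi⟩)
      simpa using this
    · rw [ap_ext_apply_top lv top e _ i hi]; rfl
  -- a lower index as an element of `Fin nS`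
  have hidx : ∀ i, lv i < top → ∃ j : Fin nS, ((e j : {i : Fin n // lv i < top}) : Fin n) = i :=
    fun i hi => ⟨e.symm ⟨i, hi⟩, by simp⟩
  -- restriction of a vector supported on the lower indices
  have hrestr : ∀ (m : Fin n → ℤ) (ℓ : ℕ), ℓ ≤ top → (∀ j, ℓ ≤ lv j → m j = 0) →
      Function.extend (fun j => ((e j : {i : Fin n // lv i < top}) : Fin n)) (fun j => m (e j)) 0 = m :=
    fun m ℓ hℓ hm => ap_ext_restrict lv top e m fun i hi => hm i (hℓ.trans (not_lt.mp hi))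
  have hprodr : ∀ (m : Fin n → ℤ) (ℓ : ℕ), ℓ ≤ top → (∀ j, ℓ ≤ lv j → m j = 0) →
      (∏ i, O.valuation (y i) ^ (m i)) = ∏ j, O.valuation (y (e j)) ^ (m (e j)) := by
    intro m ℓ hℓ hm
    conv_lhs => rw [← hrestr m ℓ hℓ hm]
    exact ap_prod_ext lv top e (fun i => O.valuation (y i)) _
  -- (C2a)
  have hC2a : ∀ i i', lv i < lv i' → ∀ m : Fin n → ℤ, (∀ j, lv i < lv j → m j = 0) →
      O.valuation (y i') < ∏ j, O.valuation (y j) ^ (m j) := by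
    intro i i' hii' m hm
    have hi : lv i < top := lt_of_lt_of_le hii' (hle i')
    have hmP : ∀ j, top ≤ lv j → m j = 0 := fun j hj => hm j (lt_of_lt_of_le hi hj)
    rcases (hle i').lt_or_eq with hi' | hi'
    · -- both lower: transfer from the residual chart
      obtain ⟨a, ha⟩ := hidx i hi
      obtain ⟨b, hb⟩ := hidx i' hi'
      have hla : lv ((e a : {i : Fin n // lv i < top}) : Fin n) = lv i := by rw [ha]
      have hlb : lv ((e b : {i : Fin n // lv i < top}) : Fin n) = lv i' := by rw [hb]
      have h := hbC2a a b (by rw [hla, hlb]; exact hii')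
        (fun j => m (e j)) (fun j hj => hm _ (by rw [hla] at hj; exact hj))
      have h2 : Ob.valuation (residue W ⟨y (e b).1, hOW (hRO (hy (e b).1))⟩) =
          ∏ j, Ob.valuation (residue W ⟨y (e j).1, hOW (hRO (hy (e j).1))⟩) ^ ((Pi.single b (1 : ℤ) : Fin nS → ℤ) j) := by
        rw [Finset.prod_eq_single b (fun j _ hj => by simp [hj]) (by simp)]; simp
      rw [h2, htr] at h
      rw [hprodr m (lv i + 1) (Nat.succ_le_of_lt hi) (fun j hj => hm j hj), ← hb]
      refine lt_of_eq_of_lt ?_ h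
      rw [Finset.prod_eq_single b (fun j _ hj => by simp [hj]) (by simp)]; simp
    · -- `i'` on top: `W`-small
      exact (hWlt _).mp (htopW i' hi') m hmP
  -- (C2b), parameters of one level
  have hC2b : ∀ i i', lv i = lv i' → ∃ N : ℕ, O.valuation (y i) ^ N < O.valuation (y i') := by
    intro i i' hii'
    rcases (hle i).lt_or_eq with hi | hi
    · have hi' : lv i' < top := hii' ▸ hi
      obtain ⟨a, ha⟩ := hidx i hi
      obtain ⟨b, hb⟩ := hidx i' hi'
      have hla : lv ((e a : {i : Fin n // lv i < top}) : Fin n) = lv i := by rw [ha]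
      have hlb : lv ((e b : {i : Fin n // lv i < top}) : Fin n) = lv i' := by rw [hb]
      obtain ⟨N, hN⟩ := hbC2b a b (by rw [hla, hlb]; exact hii')
      refine ⟨N, ?_⟩
      have h1 : Ob.valuation (residue W ⟨y (e a).1, hOW (hRO (hy (e a).1))⟩) ^ N =
          ∏ j, Ob.valuation (residue W ⟨y (e j).1, hOW (hRO (hy (e j).1))⟩) ^ ((Pi.single a (N : ℤ) : Fin nS → ℤ) j) := by
        rw [Finset.prod_eq_single a (fun j _ hj => by simp [hj]) (by simp)]; simp
      have h2 : Ob.valuation (residue W ⟨y (e b).1, hOW (hRO (hy (e b).1))⟩) =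
          ∏ j, Ob.valuation (residue W ⟨y (e j).1, hOW (hRO (hy (e j).1))⟩) ^ ((Pi.single b (1 : ℤ) : Fin nS → ℤ) j) := by
        rw [Finset.prod_eq_single b (fun j _ hj => by simp [hj]) (by simp)]; simp
      rw [h1, h2, htr] at hN
      rw [← ha, ← hb]
      refine lt_of_eq_of_lt ?_ (lt_of_lt_of_eq hN ?_)
      · rw [Finset.prod_eq_single a (fun j _ hj => by simp [hj]) (by simp)]; simp
      · rw [Finset.prod_eq_single b (fun j _ hj => by simp [hj]) (by simp)]; simp
    · -- top level: rank one of `W`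
      have hi' : lv i' = top := hii' ▸ hi
      obtain ⟨N, hN⟩ := hWr1 (y i) (y i') (htopW i hi) (hy0 i')
      refine ⟨N, ?_⟩
      have hlt : W.valuation (y i ^ N / y i') < 1 := by
        rw [map_div₀, map_pow, div_lt_one₀ ((Valuation.pos_iff _).mpr (hy0 i'))]; exact hN
      have h := hWO _ hlt
      rwa [map_div₀, map_pow, div_lt_one₀ ((Valuation.pos_iff _).mpr (hy0 i'))] at h
  exact ⟨hspan, hind, hC2a, hC2b⟩

end Up

end Summit.ResolutionOfSingularities.ResolutionOfSingularities.Theorems.PfaffLine
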